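import Mathlib
import Summits.CriticalPhenomena.SAWScalingLimit.Theorems.SAWDefectDecoherenceDefectDecoherenceTmStrata
import Summits.CriticalPhenomena.SAWScalingLimit.Theorems.SAWDefectDecoherenceDefectDecoherenceTmOrbit
import HarnessLib

/-!
# The telescoped one-step recursion (stub `stub_telescopingRecursion`)
(line `tip-martingale-depth-induction` of the crux `SAWDefectDecoherence.DefectDecoherence`,
stmt-CriticalPhenomena-8549; vocabulary `…/Theorems/SAWDefectDecoherenceTipMartingaleDefs.lean`)

`∀ φ c β B₀, (∀ m ≥ 1, 0 ≤ φ m) → 0 ≤ c → 0 < β → 0 ≤ B₀ → CrudeBound B₀ → MixingBound φ →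
ExitBound c β → RecursionStep DepthBound φ c β B₀`: for an admissible `(Λ,u,w,v,R)`, a nonnegative
profile `η` with `DepthBound ρ (η ρ)` (`ρ ≥ 1`) and scales `1 ≤ r/2^N < 2`, `r + 1 ≤ s₀`,
`s₀2^J ≤ R`, one gets `‖T(Λ,u,w,v)‖ ≤ etaNew φ c β B₀ η R r s₀ J N · M(Λ,u,w,v)`.
Proof = the helper files: first-entrance renewal at radius `r` (`tm_defect_renewal`), telescoping
over the picture scales (`defect_telescope`), `ℤ/3` orbit regrouping (`orbit_bound`) followed by
`MixingBound` at each scale and `DepthBound`/the strata bound (`strata_bound`) on the (admissible)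
picture and slit domains, and `tm_mass_renewal` to return to `M(Λ)`.  Every step is an identity or
a triangle inequality.

Sources: H. Duminil-Copin, S. Smirnov, *The connective constant of the honeycomb lattice equals
`√(2+√2)`*, Ann. of Math. 175 (2012) (arXiv:1007.0575), §1–§2 (walks between mid-edges, windings,
Definition 1); the line card `Lines/tip-martingale-depth-induction.md` of the crux.
Deliberately NOT here: the other three stubs of the line (orbit mixing, wall exit, scale
induction).
-/

noncomputable section

open scoped BigOperators ComplexConjugate Classical
open Literature.Probability.LatticeModels Literature.Probability.RandomPlanarGeometry.SAW

namespace Summit.CriticalPhenomena.SAWScalingLimit.Theorems.DefectDecoherence.TipMartingale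

section Assembly

variable {Λ : Finset HexVertex} {u w v : HexVertex} {r : ℝ}

/-- `strataSum` is nonnegative. [folklore] -/
theorem strataSum_nonneg {c β B₀ r : ℝ} {N : ℕ} {η : ℝ → ℝ} {C : ℝ} (hc : 0 ≤ c)
    (hB₀ : 0 ≤ B₀) (hη : ∀ ρ, 0 ≤ η ρ) (hC : 0 ≤ C) : 0 ≤ strataSum c β B₀ r N η C := by
  have hpow : ∀ j : ℕ, 0 ≤ (C * 2 ^ j) ^ (-β) := fun j =>
    Real.rpow_nonneg (mul_nonneg hC (pow_nonneg zero_le_two _)) _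
  exact mul_nonneg hc (add_nonneg (Finset.sum_nonneg fun j _ => mul_nonneg (hpow j) (hη _))
    (mul_nonneg (hpow N) hB₀))

/-- The exit predicate is `rot3 v`-invariant. [folklore] -/
theorem map_rot3_mem_Ex (L : ℝ) (l : List HexVertex) : l.map (rot3 v) ∈ Ex v L ↔ l ∈ Ex v L := by
  simp only [mem_Ex, List.mem_map]
  constructor
  · rintro ⟨_, ⟨q, hq, rfl⟩, h⟩
    rw [dist_rot3] at h
    exact ⟨q, hq, h⟩
  · rintro ⟨q, hq, h⟩
    exact ⟨rot3 v q, ⟨q, hq, rfl⟩, by rw [dist_rot3]; exact h⟩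

/-- **`ℤ/3` covariance of the restricted defect of picture domains.** [folklore] -/
theorem TC_picDom_rotPic {R s : ℝ} (hdeep : Deep Λ v R) (hs : s ≤ R) {E : List HexVertex → Prop}
    (hE : ∀ l : List HexVertex, E (l.map (rot3 v)) ↔ E l) (P : Picture) :
    TC (picDom Λ v s (rotPic v P)) s((rotPic v P).2.1, (rotPic v P).2.2) v E =
      (starRingEnd ℂ) (triZeta ^ 2) * TC (picDom Λ v s P) s(P.2.1, P.2.2) v E := by
  rw [picDom_rotPic hdeep hs, show s((rotPic v P).2.1, (rotPic v P).2.2) =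
    (s(P.2.1, P.2.2)).map (rot3 v) by simp [rotPic]]
  exact TC_rot3 v hE _ _

/-- **THE TELESCOPED ONE-STEP RECURSION** (stub `stub_telescopingRecursion` of the line
`tip-martingale-depth-induction`): renewal at the first entrance into `B(v,r)`, telescoping over
the picture scales `s₀2^i`, `ℤ/3` orbit regrouping and one-scale mixing at each scale, and the
strata bound for the walks leaving each picture ball, add up to `etaNew`. [folklore] -/
theorem stub_telescopingRecursion :
    ∀ (φ : ℝ → ℝ) (c β B₀ : ℝ), (∀ m, 1 ≤ m → 0 ≤ φ m) → 0 ≤ c → 0 < β → 0 ≤ B₀ →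
      CrudeBound B₀ → MixingBound φ → ExitBound c β → RecursionStep DepthBound φ c β B₀ := by
  intro φ c β B₀ hφ hc _hβ hB₀ hB hMix hE η hη hD R r s₀ J N hN1 _hN2 hs₀ hJ Λ u w v hA
  -- elementary inequalities
  have h2N : (0 : ℝ) < 2 ^ N := pow_pos two_pos N
  have hr1 : 1 ≤ r := by
    have h1 := (le_div_iff₀ h2N).1 hN1
    have h2 : (1 : ℝ) ≤ 2 ^ N := one_le_pow₀ one_le_two
    linarith
  have hr0 : 0 < r := by linarith
  have hsc_ge : ∀ i : ℕ, r + 1 ≤ s₀ * 2 ^ i := fun i =>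
    hs₀.trans (le_mul_of_one_le_right (by linarith) (one_le_pow₀ one_le_two))
  have hsc_le : ∀ i : ℕ, i ≤ J → s₀ * 2 ^ i ≤ R := fun i hi =>
    le_trans (mul_le_mul_of_nonneg_left (pow_le_pow_right₀ one_le_two hi) (by linarith)) hJ
  have hsc_pos : ∀ i : ℕ, 0 < s₀ * 2 ^ i := fun i => by linarith [hsc_ge i]
  have hs₀1 : r ≤ s₀ := by linarith
  have hs₀R : s₀ ≤ R := by simpa using hsc_le 0 (Nat.zero_le J)
  have hrR : r ≤ R := hs₀1.trans hs₀R
  have hφi : ∀ i : ℕ, i ≤ J → 0 ≤ φ (R / (s₀ * 2 ^ i)) := fun i hi =>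
    hφ _ ((one_le_div (hsc_pos i)).2 (hsc_le i hi))
  have hSS : ∀ i : ℕ, 0 ≤ strataSum c β B₀ r N η (s₀ * 2 ^ i / r) := fun i =>
    strataSum_nonneg hc hB₀ hη (div_nonneg (hsc_pos i).le hr0.le)
  have hCi : ∀ i : ℕ, 1 ≤ s₀ * 2 ^ i / r := fun i => (one_le_div hr0).2 (by linarith [hsc_ge i])
  have hCr : ∀ i : ℕ, s₀ * 2 ^ i / r * r = s₀ * 2 ^ i := fun i => div_mul_cancel₀ _ hr0.ne'
  obtain ⟨-, hadj, hu, -, -, hdeep⟩ := (admissible_iff _ _ _ _ _).1 hA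
  have hwr : r < dist (hexCenter w) (hexCenter v) := by
    have hu' : R < dist (hexCenter u) (hexCenter v) := lt_of_not_ge fun h => hu (hdeep u h)
    have h3 := dist_triangle (hexCenter u) (hexCenter w) (hexCenter v)
    have h4 := dist_hexCenter_le_one_of_adj hadj
    linarith
  have hM := mass_nonneg Λ u w v
  have hMren := tm_mass_renewal Λ u w v r hu hr1 hwr
  -- mass comparison for picture domains
  have hpdM : ∀ (s : ℝ) (y z : HexVertex) (π : HexMidEdgeSAW Λ s(u, w) s(y, z)),
      mass (picDom Λ v s (pic v s y z π)) y z v ≤ mass (Λ \ π.verts.toFinset) y z v := by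
    intro s y z π
    rw [mass_eq_TR, mass_eq_TR]
    exact TR_le_of_subset (picDom_subset π) _ _ _
  -- Step 1: renewal and telescoping
  have hT : defect Λ u w v =
      prefixSumC Λ u w v r (fun y z π => π.weight xc (5 / 8) *
        defect (picDom Λ v s₀ (pic v s₀ y z π)) y z v) +
      (∑ i ∈ Finset.range J, prefixSumC Λ u w v r (fun y z π => π.weight xc (5 / 8) *
        TC (picDom Λ v (s₀ * 2 ^ (i + 1)) (pic v (s₀ * 2 ^ (i + 1)) y z π)) s(y, z) v
          (· ∈ Ex v (s₀ * 2 ^ i)))) +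
      prefixSumC Λ u w v r (fun y z π => π.weight xc (5 / 8) *
        TC (Λ \ π.verts.toFinset) s(y, z) v (· ∈ Ex v (s₀ * 2 ^ J))) := by
    rw [tm_defect_renewal Λ u w v r hu hr1 hwr, ← prefixSumC_sum, ← prefixSumC_add,
      ← prefixSumC_add]
    refine prefixSumC_congr fun y z π hP => ?_
    rw [defect_telescope hA hr1 hP hs₀1 J hJ, mul_add, mul_add, Finset.mul_sum]
  -- Step 2: level `0`
  have hB0 : ‖prefixSumC Λ u w v r (fun y z π => π.weight xc (5 / 8) *
      defect (picDom Λ v s₀ (pic v s₀ y z π)) y z v)‖ ≤ φ (R / s₀) * η r * mass Λ u w v := by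
    have cov : ∀ P : Picture, defect (picDom Λ v s₀ (rotPic v P)) (rotPic v P).2.1
        (rotPic v P).2.2 v = (starRingEnd ℂ) (triZeta ^ 2) *
          defect (picDom Λ v s₀ P) P.2.1 P.2.2 v := fun P => by
      rw [defect_eq_TC, defect_eq_TC]
      exact TC_picDom_rotPic hdeep hs₀R (fun _ => Iff.rfl) P
    calc _ ≤ _ := orbit_bound v r s₀ (fun P => defect (picDom Λ v s₀ P) P.2.1 P.2.2 v) cov
      _ ≤ prefixSumR Λ u w v r (fun y z π => η r * (contraction Λ u w v r s₀ (pic v s₀ y z π) *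
          (xc ^ π.length * mass (picDom Λ v s₀ (pic v s₀ y z π)) y z v))) := by
        refine prefixSumR_mono fun y z π hP => ?_
        have h1 : ‖defect (picDom Λ v s₀ (pic v s₀ y z π)) y z v‖ ≤
            η r * mass (picDom Λ v s₀ (pic v s₀ y z π)) y z v :=
          hD r hr1 _ _ _ _ (admissible_picDom hA hr1 hs₀1 hs₀R hP)
        have h2 : 0 ≤ contraction Λ u w v r s₀ (pic v s₀ y z π) :=
          div_nonneg (norm_nonneg _) (Finset.sum_nonneg fun k _ => picMass_nonneg v r s₀ _)
        calc _ ≤ contraction Λ u w v r s₀ (pic v s₀ y z π) * (xc ^ π.length *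
              (η r * mass (picDom Λ v s₀ (pic v s₀ y z π)) y z v)) :=
              mul_le_mul_of_nonneg_left (mul_le_mul_of_nonneg_left h1 (pow_nonneg xc_pos.le _))
                h2
          _ = _ := by ring
      _ = η r * prefixSumR Λ u w v r (fun y z π => contraction Λ u w v r s₀ (pic v s₀ y z π) *
          (xc ^ π.length * mass (picDom Λ v s₀ (pic v s₀ y z π)) y z v)) :=
        prefixSumR_mul_left _ _
      _ ≤ η r * (φ (R / s₀) * prefixSumR Λ u w v r (fun y z π =>
          xc ^ π.length * mass (picDom Λ v s₀ (pic v s₀ y z π)) y z v)) :=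
        mul_le_mul_of_nonneg_left (hMix Λ u w v R hA r s₀ hr1 hs₀ hs₀R) (hη r)
      _ ≤ η r * (φ (R / s₀) * prefixSumR Λ u w v r (fun y z π =>
          xc ^ π.length * mass (Λ \ π.verts.toFinset) y z v)) := by
        refine mul_le_mul_of_nonneg_left (mul_le_mul_of_nonneg_left (prefixSumR_mono
          fun y z π _ => mul_le_mul_of_nonneg_left (hpdM s₀ y z π) (pow_nonneg xc_pos.le _)) ?_)
          (hη r)
        simpa using hφi 0 (Nat.zero_le J)
      _ = φ (R / s₀) * η r * mass Λ u w v := by rw [← hMren]; ring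
  -- Step 3: levels `i + 1`
  have hBi : ∀ i ∈ Finset.range J, ‖prefixSumC Λ u w v r (fun y z π => π.weight xc (5 / 8) *
      TC (picDom Λ v (s₀ * 2 ^ (i + 1)) (pic v (s₀ * 2 ^ (i + 1)) y z π)) s(y, z) v
        (· ∈ Ex v (s₀ * 2 ^ i)))‖ ≤
      φ (R / (s₀ * 2 ^ (i + 1))) * strataSum c β B₀ r N η (s₀ * 2 ^ i / r) * mass Λ u w v := by
    intro i hi
    have hi' : i + 1 ≤ J := Finset.mem_range.1 hi
    have hsi1 : r ≤ s₀ * 2 ^ (i + 1) := by linarith [hsc_ge (i + 1)]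
    have cov : ∀ P : Picture, TC (picDom Λ v (s₀ * 2 ^ (i + 1)) (rotPic v P))
        s((rotPic v P).2.1, (rotPic v P).2.2) v (· ∈ Ex v (s₀ * 2 ^ i)) =
          (starRingEnd ℂ) (triZeta ^ 2) * TC (picDom Λ v (s₀ * 2 ^ (i + 1)) P)
            s(P.2.1, P.2.2) v (· ∈ Ex v (s₀ * 2 ^ i)) := fun P =>
      TC_picDom_rotPic hdeep (hsc_le _ hi') (map_rot3_mem_Ex _) P
    calc _ ≤ _ := orbit_bound v r (s₀ * 2 ^ (i + 1)) (fun P =>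
          TC (picDom Λ v (s₀ * 2 ^ (i + 1)) P) s(P.2.1, P.2.2) v (· ∈ Ex v (s₀ * 2 ^ i))) cov
      _ ≤ prefixSumR Λ u w v r (fun y z π => strataSum c β B₀ r N η (s₀ * 2 ^ i / r) *
          (contraction Λ u w v r (s₀ * 2 ^ (i + 1)) (pic v (s₀ * 2 ^ (i + 1)) y z π) *
          (xc ^ π.length * mass (picDom Λ v (s₀ * 2 ^ (i + 1))
            (pic v (s₀ * 2 ^ (i + 1)) y z π)) y z v))) := by
        refine prefixSumR_mono fun y z π hP => ?_
        have h1 : ‖TC (picDom Λ v (s₀ * 2 ^ (i + 1)) (pic v (s₀ * 2 ^ (i + 1)) y z π)) s(y, z) v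
            (· ∈ Ex v (s₀ * 2 ^ i))‖ ≤ strataSum c β B₀ r N η (s₀ * 2 ^ i / r) *
              mass (picDom Λ v (s₀ * 2 ^ (i + 1)) (pic v (s₀ * 2 ^ (i + 1)) y z π)) y z v :=
          strata_bound hc hη hD hB hE hN1 (hCi i)
            (admissible_picDom hA hr1 hsi1 (hsc_le _ hi') hP) ((isPrefix_iff π).1 hP).2.2.1
            (hCr i)
        have h2 : 0 ≤ contraction Λ u w v r (s₀ * 2 ^ (i + 1)) (pic v (s₀ * 2 ^ (i + 1)) y z π) :=
          div_nonneg (norm_nonneg _) (Finset.sum_nonneg fun k _ => picMass_nonneg v r _ _)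
        calc _ ≤ contraction Λ u w v r (s₀ * 2 ^ (i + 1)) (pic v (s₀ * 2 ^ (i + 1)) y z π) *
              (xc ^ π.length * (strataSum c β B₀ r N η (s₀ * 2 ^ i / r) *
                mass (picDom Λ v (s₀ * 2 ^ (i + 1)) (pic v (s₀ * 2 ^ (i + 1)) y z π)) y z v)) :=
              mul_le_mul_of_nonneg_left (mul_le_mul_of_nonneg_left h1 (pow_nonneg xc_pos.le _))
                h2
          _ = _ := by ring
      _ = strataSum c β B₀ r N η (s₀ * 2 ^ i / r) * prefixSumR Λ u w v r (fun y z π =>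
          contraction Λ u w v r (s₀ * 2 ^ (i + 1)) (pic v (s₀ * 2 ^ (i + 1)) y z π) *
          (xc ^ π.length * mass (picDom Λ v (s₀ * 2 ^ (i + 1))
            (pic v (s₀ * 2 ^ (i + 1)) y z π)) y z v)) := prefixSumR_mul_left _ _
      _ ≤ strataSum c β B₀ r N η (s₀ * 2 ^ i / r) * (φ (R / (s₀ * 2 ^ (i + 1))) *
          prefixSumR Λ u w v r (fun y z π => xc ^ π.length *
            mass (picDom Λ v (s₀ * 2 ^ (i + 1)) (pic v (s₀ * 2 ^ (i + 1)) y z π)) y z v)) :=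
        mul_le_mul_of_nonneg_left (hMix Λ u w v R hA r (s₀ * 2 ^ (i + 1)) hr1 (hsc_ge _)
          (hsc_le _ hi')) (hSS i)
      _ ≤ strataSum c β B₀ r N η (s₀ * 2 ^ i / r) * (φ (R / (s₀ * 2 ^ (i + 1))) *
          prefixSumR Λ u w v r (fun y z π => xc ^ π.length *
            mass (Λ \ π.verts.toFinset) y z v)) :=
        mul_le_mul_of_nonneg_left (mul_le_mul_of_nonneg_left (prefixSumR_mono
          fun y z π _ => mul_le_mul_of_nonneg_left (hpdM _ y z π) (pow_nonneg xc_pos.le _))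
            (hφi _ hi')) (hSS i)
      _ = _ := by rw [← hMren]; ring
  -- Step 4: the walks leaving the last picture ball
  have hBX : ‖prefixSumC Λ u w v r (fun y z π => π.weight xc (5 / 8) *
      TC (Λ \ π.verts.toFinset) s(y, z) v (· ∈ Ex v (s₀ * 2 ^ J)))‖ ≤
      strataSum c β B₀ r N η (s₀ * 2 ^ J / r) * mass Λ u w v := by
    calc _ ≤ prefixSumR Λ u w v r (fun y z π => xc ^ π.length *
          (strataSum c β B₀ r N η (s₀ * 2 ^ J / r) * mass (Λ \ π.verts.toFinset) y z v)) :=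
          norm_prefixSumC_le _ _ fun y z π hP => strata_bound hc hη hD hB hE hN1 (hCi J)
            (admissible_sdiff hA hr1 hrR hP) ((isPrefix_iff π).1 hP).2.2.1 (hCr J)
      _ = strataSum c β B₀ r N η (s₀ * 2 ^ J / r) * prefixSumR Λ u w v r (fun y z π =>
          xc ^ π.length * mass (Λ \ π.verts.toFinset) y z v) := by
          rw [← prefixSumR_mul_left]
          congr 1; funext y z π; ring
      _ = _ := by rw [← hMren]
  -- conclusion
  rw [hT]
  refine ((norm_add_le _ _).trans (add_le_add ((norm_add_le _ _).trans (add_le_add hB0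
    ((norm_sum_le _ _).trans (Finset.sum_le_sum hBi)))) hBX)).trans (le_of_eq ?_)
  rw [etaNew, add_mul, add_mul, Finset.sum_mul]

end Assembly

end Summit.CriticalPhenomena.SAWScalingLimit.Theorems.DefectDecoherence.TipMartingale

end
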